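import Literature.NumberTheory.Sieve.RoughModelPairCorrelation
import HarnessLib

/-!
# The variance of a weight against the rough model: expansion into pair correlations, PROVED

Topic `Literature/NumberTheory/Sieve`, namespace `Literature.NumberTheory.Sieve.CubicMinorant` (the
rough model `g = roughModel B (2N)`, `g(m) = (P/φ(P))·1[(m, P) = 1]`, `P = P(z)`, `z = (log 2N)^B`, and
its pair singular series `𝔖_z(h) = pairSingSeries B (2N) h` of `RoughModelPairCorrelation.lean`).

The DISPERSION (variance) of a binary problem `n = k + m` with one summand weighted by an arbitrary
real weight `w` on `[1, N]` and the other replaced by the rough model at `2N`: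
`V(w) = ∑_{N < n ≤ 2N} (∑_{k ≤ N} w(k) g(n − k))²`.  We PROVE the three standard steps
[Vaughan1997, §3.2; BombieriFriedlanderIwaniecActa1986, §3 (dispersion: open the square, evaluate the
inner sums, collect residue classes)]:

* **`variance_eq_sum_sum_pairCorrelation`** — opening the square and shifting:
  `V(w) = ∑_{k,k' ≤ N} w(k) w(k') ∑_{N−max(k,k') < m ≤ 2N−max(k,k')} g(m) g(m + |k − k'|)` (exact).
* **`abs_variance_sub_mainPart_le`** — by the pair-correlation asymptotic of the rough model
  (tree `exists_pairCorrelation_bound`, Fundamental Lemma): with an absolute `C`, for `2 ≤ z ≤ D`,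
  `|V(w) − N ∑_{k,k'} w(k)w(k') 𝔖_z(|k−k'|)| ≤ C (N (P/φ(P)) e^{−log D/log z} + D z⁴) (∑_k |w(k)|)²`.
* **`sum_sum_mul_pairSingSeries_eq`** — the divisor expansion of `𝔖_z` (tree
  `pairSingSeries_eq_sum_powerset`) followed by the residue-class rearrangement (tree
  `sum_sum_mul_ite_modEq_eq_sum_sq`): for `z > 2` and any finite `K ⊆ ℕ`,
  `∑_{k,k'∈K} w(k)w(k') 𝔖_z(|k−k'|) = κ_z ∑_{t ⊆ S'} (∏_{p∈t} 1/(p−2)) ∑_{r mod 2∏t} (∑_{k∈K, k≡r} w(k))²`,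
  `S'` the odd primes below `z`, `κ_z = pairSingConst B (2N) ∈ (0, 2]` (`pairSingConst_le_two`) —
  every term nonnegative, so the main part is controlled class by class and modulus by modulus.
* `sum_sq_sub_le_of_le` — the elementary class-by-class bound
  `∑_r (A_r − B_r)² ≤ a ∑_r A_r + b ∑_r B_r` for `0 ≤ A_r ≤ a`, `0 ≤ B_r ≤ b`, and
  `sum_range_sum_filter_modEq` — `∑_{r<m} ∑_{k∈K, k≡r (m)} f(k) = ∑_{k∈K} f(k)`.

No new facts (0 `def … : Prop`).  Written for the parity-ideate cell (route `GoldbachHeathBrownDispersion`,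
crux ModelDispersion; literature seat g14, 2026-08-27).

## References

* [Vaughan1997] R. C. Vaughan, *The Hardy–Littlewood method*, 2nd ed., CUP 1997, §3.2 (binary problems,
  variance over `n`).
* [BombieriFriedlanderIwaniecActa1986] E. Bombieri, J. B. Friedlander, H. Iwaniec, *Primes in arithmetic
  progressions to large moduli*, Acta Math. 156 (1986), §3 (the dispersion method).
* [HalberstamRichert1974] H. Halberstam, H.-E. Richert, *Sieve Methods*, Thm 2.5, (1.4.14), Ch. 10 §1.

## Mathlib / tree search

Tree: `exists_pairCorrelation_bound`, `pairSingSeries_eq_sum_powerset`, `two_mul_prod_dvd_iff`,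
`sum_sum_mul_ite_modEq_eq_sum_sq`, `pairSingSeries_le_primorial_div_totient`, `pairSingConst(_pos)`,
`oddPrimesBelow` (`RoughModelPairCorrelation`). Mathlib: `Finset.sum_mul_sum`, `Finset.sum_comm`,
`Finset.map_add_right_Ioc`, `Nat.modEq_iff_dvd'`, `Finset.sum_fiberwise_of_maps_to`.
`lean search 'variance_eq_sum_sum|mainPart'`: nothing relevant before this file.
-/

noncomputable section

open Finset Filter
open Literature.NumberTheory.Sieve

namespace Literature.NumberTheory.Sieve.CubicMinorant

/-! ### Opening the square -/

/-- The inner sum over `n`, shifted: for `k, k' ≤ N`,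
`∑_{N<n≤2N} g(n−k) g(n−k') = ∑_{N−M < m ≤ 2N−M} g(m) g(m + (M − μ))`, `M = max(k,k')`, `μ = min(k,k')`.
[cite: Vaughan1997, §3.2 (binary problems: the variance over n)] -/
theorem sum_roughModel_shift_eq (B : ℝ) {N k k' : ℕ} (hk : k ≤ N) (hk' : k' ≤ N) :
    ∑ n ∈ Ioc N (2 * N), roughModel B (2 * N) (n - k) * roughModel B (2 * N) (n - k') =
      ∑ m ∈ Ioc (N - max k k') (N - max k k' + N),
        roughModel B (2 * N) m * roughModel B (2 * N) (m + (max k k' - min k k')) := by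
  rcases le_total k k' with h | h
  · rw [max_eq_right h, min_eq_left h]
    have hshift : Ioc N (2 * N) = (Ioc (N - k') (N - k' + N)).map (addRightEmbedding k') := by
      rw [map_add_right_Ioc]
      congr 1 <;> omega
    rw [hshift, sum_map]
    refine sum_congr rfl fun m _ => ?_
    simp only [addRightEmbedding_apply]
    rw [show m + k' - k = m + (k' - k) by omega, show m + k' - k' = m by omega, mul_comm]
  · rw [max_eq_left h, min_eq_right h]
    have hshift : Ioc N (2 * N) = (Ioc (N - k) (N - k + N)).map (addRightEmbedding k) := by
      rw [map_add_right_Ioc]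
      congr 1 <;> omega
    rw [hshift, sum_map]
    refine sum_congr rfl fun m _ => ?_
    simp only [addRightEmbedding_apply]
    rw [show m + k - k = m by omega, show m + k - k' = m + (k - k') by omega]

/-- **Opening the square**: `V(w) = ∑_{k,k'≤N} w(k)w(k') ∑_{N−max<m≤2N−max} g(m) g(m + |k−k'|)`.
[cite: Vaughan1997, §3.2 (binary problems: the variance over n)] -/
theorem variance_eq_sum_sum_pairCorrelation (B : ℝ) (N : ℕ) (w : ℕ → ℝ) :
    ∑ n ∈ Ioc N (2 * N), (∑ k ∈ Icc 1 N, w k * roughModel B (2 * N) (n - k)) ^ 2 =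
      ∑ k ∈ Icc 1 N, ∑ k' ∈ Icc 1 N, w k * w k' *
        ∑ m ∈ Ioc (N - max k k') (N - max k k' + N),
          roughModel B (2 * N) m * roughModel B (2 * N) (m + (max k k' - min k k')) := by
  have hsq : ∀ n : ℕ, (∑ k ∈ Icc 1 N, w k * roughModel B (2 * N) (n - k)) ^ 2 =
      ∑ k ∈ Icc 1 N, ∑ k' ∈ Icc 1 N,
        w k * w k' * (roughModel B (2 * N) (n - k) * roughModel B (2 * N) (n - k')) := by
    intro n
    rw [sq, sum_mul_sum]
    exact sum_congr rfl fun k _ => sum_congr rfl fun k' _ => by ring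
  simp_rw [hsq]
  rw [sum_comm]
  refine sum_congr rfl fun k hk => ?_
  rw [sum_comm]
  refine sum_congr rfl fun k' hk' => ?_
  rw [← mul_sum, sum_roughModel_shift_eq B (mem_Icc.mp hk).2 (mem_Icc.mp hk').2]

/-! ### The main part and the error -/

/-- **The variance against its main part** (absolute constant): for `2 ≤ z ≤ D`, `z = (log 2N)^B`,
`|V(w) − N ∑_{k,k'} w(k)w(k') 𝔖_z(|k−k'|)| ≤ C (N (P/φ(P)) e^{−log D/log z} + D z⁴) (∑_k |w(k)|)²`.
[cite: BombieriFriedlanderIwaniecActa1986, §3 (the dispersion method: evaluation of the inner sums)] -/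
theorem abs_variance_sub_mainPart_le (B : ℝ) :
    ∃ C : ℝ, 0 < C ∧ ∀ (N : ℕ) (w : ℕ → ℝ) (D : ℝ), 2 ≤ roughLevel B (2 * N) →
      roughLevel B (2 * N) ≤ D →
      |∑ n ∈ Ioc N (2 * N), (∑ k ∈ Icc 1 N, w k * roughModel B (2 * N) (n - k)) ^ 2 -
          N * ∑ k ∈ Icc 1 N, ∑ k' ∈ Icc 1 N,
            w k * w k' * pairSingSeries B (2 * N) (max k k' - min k k')| ≤
        C * ((N : ℝ) * ((roughPrimorial B (2 * N) : ℝ) / (Nat.totient (roughPrimorial B (2 * N)) : ℝ)) *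
              Real.exp (-(Real.log D / Real.log (roughLevel B (2 * N)))) +
            D * roughLevel B (2 * N) ^ 4) *
          (∑ k ∈ Icc 1 N, |w k|) ^ 2 := by
  obtain ⟨C, hC, hpc⟩ := exists_pairCorrelation_bound B
  refine ⟨C, hC, fun N w D hz hzD => ?_⟩
  set z := roughLevel B (2 * N) with hzdef
  set Q : ℝ := (roughPrimorial B (2 * N) : ℝ) / (Nat.totient (roughPrimorial B (2 * N)) : ℝ) with hQ
  set ε : ℝ := Real.exp (-(Real.log D / Real.log z)) with hε
  have hD0 : 0 ≤ D := by linarith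
  have hz0 : 0 ≤ z := by linarith
  rw [variance_eq_sum_sum_pairCorrelation, mul_sum, ← sum_sub_distrib]
  -- termwise: `|w w' (G − N𝔖)| ≤ |w||w'| C (N Q ε + D z⁴)`
  have hterm : ∀ k ∈ Icc 1 N, ∀ k' ∈ Icc 1 N,
      |w k * w k' * ∑ m ∈ Ioc (N - max k k') (N - max k k' + N),
            roughModel B (2 * N) m * roughModel B (2 * N) (m + (max k k' - min k k')) -
          N * (w k * w k' * pairSingSeries B (2 * N) (max k k' - min k k'))| ≤
        |w k| * |w k'| * (C * (N * Q * ε + D * z ^ 4)) := by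
    intro k _ k' _
    set h := max k k' - min k k' with hh
    have hb := hpc (2 * N) (N - max k k') N h D hz hzD
    have h𝔖Q : pairSingSeries B (2 * N) h ≤ Q := pairSingSeries_le_primorial_div_totient B (2 * N) h
    have h𝔖0 : 0 ≤ pairSingSeries B (2 * N) h := pairSingSeries_nonneg B (2 * N) h
    have hε0 : 0 ≤ ε := Real.exp_nonneg _
    have hb' : |∑ m ∈ Ioc (N - max k k') (N - max k k' + N),
          roughModel B (2 * N) m * roughModel B (2 * N) (m + h) - N * pairSingSeries B (2 * N) h| ≤
        C * (N * Q * ε + D * z ^ 4) := by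
      refine hb.trans (mul_le_mul_of_nonneg_left ?_ hC.le)
      have : (N : ℝ) * pairSingSeries B (2 * N) h * ε ≤ N * Q * ε :=
        mul_le_mul_of_nonneg_right (mul_le_mul_of_nonneg_left h𝔖Q (Nat.cast_nonneg N)) hε0
      linarith
    rw [show w k * w k' * ∑ m ∈ Ioc (N - max k k') (N - max k k' + N),
          roughModel B (2 * N) m * roughModel B (2 * N) (m + h) -
        N * (w k * w k' * pairSingSeries B (2 * N) h) =
        (w k * w k') * (∑ m ∈ Ioc (N - max k k') (N - max k k' + N),
          roughModel B (2 * N) m * roughModel B (2 * N) (m + h) - N * pairSingSeries B (2 * N) h) by ring,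
      abs_mul, abs_mul]
    exact mul_le_mul_of_nonneg_left hb' (by positivity)
  calc |∑ k ∈ Icc 1 N, (∑ k' ∈ Icc 1 N, w k * w k' *
            ∑ m ∈ Ioc (N - max k k') (N - max k k' + N),
              roughModel B (2 * N) m * roughModel B (2 * N) (m + (max k k' - min k k')) -
          N * ∑ k' ∈ Icc 1 N, w k * w k' * pairSingSeries B (2 * N) (max k k' - min k k'))|
      = |∑ k ∈ Icc 1 N, ∑ k' ∈ Icc 1 N, (w k * w k' *
            ∑ m ∈ Ioc (N - max k k') (N - max k k' + N),
              roughModel B (2 * N) m * roughModel B (2 * N) (m + (max k k' - min k k')) -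
          N * (w k * w k' * pairSingSeries B (2 * N) (max k k' - min k k')))| := by
        congr 1
        refine sum_congr rfl fun k _ => ?_
        rw [mul_sum, ← sum_sub_distrib]
    _ ≤ ∑ k ∈ Icc 1 N, ∑ k' ∈ Icc 1 N, |w k * w k' *
            ∑ m ∈ Ioc (N - max k k') (N - max k k' + N),
              roughModel B (2 * N) m * roughModel B (2 * N) (m + (max k k' - min k k')) -
          N * (w k * w k' * pairSingSeries B (2 * N) (max k k' - min k k'))| :=
        (abs_sum_le_sum_abs _ _).trans (sum_le_sum fun k _ => abs_sum_le_sum_abs _ _)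
    _ ≤ ∑ k ∈ Icc 1 N, ∑ k' ∈ Icc 1 N, |w k| * |w k'| * (C * (N * Q * ε + D * z ^ 4)) :=
        sum_le_sum fun k hk => sum_le_sum fun k' hk' => hterm k hk k' hk'
    _ = C * (N * Q * ε + D * z ^ 4) * (∑ k ∈ Icc 1 N, |w k|) ^ 2 := by
        rw [sq, sum_mul_sum, mul_sum]
        refine sum_congr rfl fun k _ => ?_
        rw [mul_sum]
        exact sum_congr rfl fun k' _ => by ring

/-! ### The main part as a nonnegative combination of class sums -/

/-- `κ_z ≤ 2` (each factor `p(p−2)/(p−1)² ≤ 1`). [cite: HalberstamRichert1974, Ch. 10 §1 (the twin-prime constant as a product over odd primes)] -/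
theorem pairSingConst_le_two (B : ℝ) (N : ℕ) : pairSingConst B N ≤ 2 := by
  rw [pairSingConst]
  have h : ∏ p ∈ oddPrimesBelow (roughLevel B N), ((p : ℝ) * ((p : ℝ) - 2) / ((p : ℝ) - 1) ^ 2) ≤ 1 := by
    refine prod_le_one (fun p hp => ?_) fun p hp => ?_
    · obtain ⟨hp2, hp'⟩ := mem_oddPrimesBelow.mp hp
      have hpp := Nat.prime_of_mem_primesBelow hp'
      have h3 : (3 : ℝ) ≤ p := by
        have : 3 ≤ p := by
          rcases hpp.eq_two_or_odd' with h | h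
          · exact absurd h hp2
          · have := hpp.two_le; rcases h with ⟨k, hk⟩; omega
        exact_mod_cast this
      exact div_nonneg (mul_nonneg (by linarith) (by linarith)) (sq_nonneg _)
    · obtain ⟨hp2, hp'⟩ := mem_oddPrimesBelow.mp hp
      have hpp := Nat.prime_of_mem_primesBelow hp'
      have h3 : (3 : ℝ) ≤ p := by
        have : 3 ≤ p := by
          rcases hpp.eq_two_or_odd' with h | h
          · exact absurd h hp2
          · have := hpp.two_le; rcases h with ⟨k, hk⟩; omega
        exact_mod_cast this
      rw [div_le_one (by nlinarith)]
      nlinarith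
  linarith

/-- For `k, k'` and a modulus `m`: `m ∣ max(k,k') − min(k,k') ↔ k ≡ k' (mod m)`. [folklore] -/
private theorem dvd_max_sub_min_iff (m k k' : ℕ) : m ∣ max k k' - min k k' ↔ k ≡ k' [MOD m] := by
  rcases le_total k k' with h | h
  · rw [max_eq_right h, min_eq_left h, ← Nat.modEq_iff_dvd' h]
  · rw [max_eq_left h, min_eq_right h, ← Nat.modEq_iff_dvd' h]
    exact ⟨Nat.ModEq.symm, Nat.ModEq.symm⟩

/-- **The main part, expanded over moduli and residue classes** (for `z > 2`): with `S'` the odd primes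
below `z` and `κ_z = pairSingConst`,
`∑_{k,k'∈K} w(k)w(k') 𝔖_z(|k−k'|) = κ_z ∑_{t ⊆ S'} (∏_{p∈t} (p−2)⁻¹) ∑_{r < 2∏t} (∑_{k∈K, k ≡ r (2∏t)} w(k))²`.
[cite: BombieriFriedlanderIwaniecActa1986, §3 (the dispersion method: opening the square and collecting residue classes)] -/
theorem sum_sum_mul_pairSingSeries_eq (B : ℝ) (N : ℕ) (w : ℕ → ℝ) (K : Finset ℕ)
    (hz : 2 < roughLevel B N) :
    ∑ k ∈ K, ∑ k' ∈ K, w k * w k' * pairSingSeries B N (max k k' - min k k') =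
      pairSingConst B N * ∑ t ∈ (oddPrimesBelow (roughLevel B N)).powerset,
        (∏ p ∈ t, (1 / ((p : ℝ) - 2))) *
          ∑ r ∈ range (2 * ∏ p ∈ t, p),
            (∑ k ∈ K.filter (fun k : ℕ => k ≡ r [MOD 2 * ∏ p ∈ t, p]), w k) ^ 2 := by
  set S := (oddPrimesBelow (roughLevel B N)).powerset with hS
  -- Step 1: termwise expansion of `𝔖` and conversion of the divisibility indicator into a congruence
  have hterm : ∀ k k' : ℕ, w k * w k' * pairSingSeries B N (max k k' - min k k') =
      pairSingConst B N * ∑ t ∈ S, (∏ p ∈ t, (1 / ((p : ℝ) - 2))) *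
        (w k * w k' * if k ≡ k' [MOD 2 * ∏ p ∈ t, p] then 1 else 0) := by
    intro k k'
    rw [pairSingSeries_eq_sum_powerset B N _ hz, mul_sum, mul_sum, mul_sum]
    refine sum_congr rfl fun t ht => ?_
    have ht' : t ⊆ oddPrimesBelow (roughLevel B N) := mem_powerset.mp ht
    have hiff : (2 ∣ max k k' - min k k' ∧ ∀ p ∈ t, p ∣ max k k' - min k k') ↔
        k ≡ k' [MOD 2 * ∏ p ∈ t, p] := by
      rw [← two_mul_prod_dvd_iff ht', dvd_max_sub_min_iff]
    have key : ((if 2 ∣ max k k' - min k k' then (1 : ℝ) else 0) *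
        if (∀ p ∈ t, p ∣ max k k' - min k k') then ∏ p ∈ t, (1 / ((p : ℝ) - 2)) else 0) =
        (∏ p ∈ t, (1 / ((p : ℝ) - 2))) * if k ≡ k' [MOD 2 * ∏ p ∈ t, p] then 1 else 0 := by
      by_cases hc : k ≡ k' [MOD 2 * ∏ p ∈ t, p]
      · obtain ⟨h2, hall⟩ := hiff.mpr hc
        rw [if_pos h2, if_pos hall, if_pos hc, one_mul, mul_one]
      · rw [if_neg hc, mul_zero]
        by_cases h2 : 2 ∣ max k k' - min k k'
        · have hall : ¬ ∀ p ∈ t, p ∣ max k k' - min k k' := fun hall => hc (hiff.mp ⟨h2, hall⟩)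
          rw [if_neg hall, mul_zero]
        · rw [if_neg h2, zero_mul]
    calc w k * w k' * ((if 2 ∣ max k k' - min k k' then (1 : ℝ) else 0) * pairSingConst B N *
          if (∀ p ∈ t, p ∣ max k k' - min k k') then ∏ p ∈ t, (1 / ((p : ℝ) - 2)) else 0)
        = pairSingConst B N * (w k * w k') * (((if 2 ∣ max k k' - min k k' then (1 : ℝ) else 0) *
          if (∀ p ∈ t, p ∣ max k k' - min k k') then ∏ p ∈ t, (1 / ((p : ℝ) - 2)) else 0)) := by ring
      _ = pairSingConst B N * (w k * w k') * ((∏ p ∈ t, (1 / ((p : ℝ) - 2))) *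
          if k ≡ k' [MOD 2 * ∏ p ∈ t, p] then 1 else 0) := by rw [key]
      _ = _ := by ring
  simp_rw [hterm]
  -- Step 2: exchange the sums and rearrange each modulus class by class
  simp_rw [← mul_sum]
  congr 1
  have h1 : ∀ k ∈ K, ∑ k' ∈ K, ∑ t ∈ S, (∏ p ∈ t, (1 / ((p : ℝ) - 2))) *
        (w k * w k' * if k ≡ k' [MOD 2 * ∏ p ∈ t, p] then 1 else 0) =
      ∑ t ∈ S, ∑ k' ∈ K, (∏ p ∈ t, (1 / ((p : ℝ) - 2))) *
        (w k * w k' * if k ≡ k' [MOD 2 * ∏ p ∈ t, p] then 1 else 0) := fun k _ => sum_comm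
  rw [sum_congr rfl h1, sum_comm]
  refine sum_congr rfl fun t ht => ?_
  have ht' : t ⊆ oddPrimesBelow (roughLevel B N) := mem_powerset.mp ht
  have hm : 0 < 2 * ∏ p ∈ t, p :=
    Nat.mul_pos two_pos (prod_pos fun p hp =>
      (Nat.prime_of_mem_primesBelow (mem_oddPrimesBelow.mp (ht' hp)).2).pos)
  simp_rw [← mul_sum]
  rw [sum_sum_mul_ite_modEq_eq_sum_sq K w hm]

/-! ### Two elementary tools for the class-by-class bounds -/

/-- Class-by-class bound for a difference of two nonnegative class distributions:
`∑_r (A_r − B_r)² ≤ a ∑_r A_r + b ∑_r B_r` when `0 ≤ A_r ≤ a` and `0 ≤ B_r ≤ b`.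
[cite: BombieriFriedlanderIwaniecActa1986, §3 (the dispersion method: opening the square and collecting residue classes)] -/
theorem sum_sq_sub_le_of_le (s : Finset ℕ) {A B : ℕ → ℝ} {a b : ℝ}
    (hA0 : ∀ r ∈ s, 0 ≤ A r) (hA : ∀ r ∈ s, A r ≤ a) (hB0 : ∀ r ∈ s, 0 ≤ B r) (hB : ∀ r ∈ s, B r ≤ b) :
    ∑ r ∈ s, (A r - B r) ^ 2 ≤ a * ∑ r ∈ s, A r + b * ∑ r ∈ s, B r := by
  rw [mul_sum, mul_sum, ← sum_add_distrib]
  refine sum_le_sum fun r hr => ?_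
  have h1 : (A r - B r) ^ 2 ≤ A r ^ 2 + B r ^ 2 := by nlinarith [hA0 r hr, hB0 r hr]
  have h2 : A r ^ 2 ≤ a * A r := by nlinarith [hA0 r hr, hA r hr]
  have h3 : B r ^ 2 ≤ b * B r := by nlinarith [hB0 r hr, hB r hr]
  linarith

/-- The residue classes `mod m` partition any finite set of naturals:
`∑_{r<m} ∑_{k∈K, k≡r (m)} f(k) = ∑_{k∈K} f(k)` (`m > 0`).
[cite: BombieriFriedlanderIwaniecActa1986, §3 (the dispersion method: opening the square and collecting residue classes)] -/
theorem sum_range_sum_filter_modEq (K : Finset ℕ) (f : ℕ → ℝ) {m : ℕ} (hm : 0 < m) :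
    ∑ r ∈ range m, ∑ k ∈ K.filter (fun k : ℕ => k ≡ r [MOD m]), f k = ∑ k ∈ K, f k := by
  have hfilt : ∀ r ∈ range m, K.filter (fun k : ℕ => k ≡ r [MOD m]) = K.filter (fun k : ℕ => k % m = r) := by
    intro r hr
    refine filter_congr fun k _ => ?_
    rw [Nat.ModEq, Nat.mod_eq_of_lt (mem_range.mp hr)]
  rw [sum_congr rfl fun r hr => by rw [hfilt r hr]]
  exact sum_fiberwise_of_maps_to (fun k _ => mem_range.mpr (Nat.mod_lt k hm)) f

end Literature.NumberTheory.Sieve.CubicMinorant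

end
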